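import Mathlib.MeasureTheory.Integral.Lebesgue.DominatedConvergence
import Literature.MathematicalPhysics.KineticTheory.EvenCollisionTubeFunctional
import Literature.MathematicalPhysics.KineticTheory.HardSphereEulerProofs
import HarnessLib

/-!
# Collision tail marks and the tail kinetic energy

Topic `Literature/MathematicalPhysics/KineticTheory` — companion of `EvenCollisionTubeFunctional.lean`
(vocabulary of the line `even-rung-mean-variance` of the crux `JParityClosure.EvenStressEnskog`,
stmt-AtomisticToContinuum-13079).  The velocity-truncation step of that line (its stub S1) replaces the
unbounded momentum-transfer mark `Ξ_P^{kl} = evenMark k l` by the truncation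
`Ξ_L^{kl} = evenMarkTrunc k l L` at relative speed `L`; its error is governed by two TAIL objects, which
this file names, together with their elementary API:

* `speedTailMark L` — the continuous **speed-tail mark** `m_L(n, v, w) = ‖w − v‖ (1 − ψ_L(‖w − v‖))`
  (`ψ_L = speedCutoff L`): nonnegative, `= 0` for `‖w − v‖ ≤ L`, `≤ ‖w − v‖`; at unit normal it
  dominates the truncation error, `|Ξ_P^{kl} − Ξ_L^{kl}| ≤ m_L` (`abs_evenMark_sub_evenMarkTrunc_le`), so
  that the collision sum of `m_L` controls the collision side of the truncation;
* `velTail L v = ‖v‖² 1{L/2 < ‖v‖}` and the **tail kinetic energy per particle**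
  `tailEnergy L z = (N+1)⁻¹ Σᵢ velTail L vᵢ` of a configuration of `N + 1` spheres: measurable,
  `0 ≤ tailEnergy L z ≤ 2 E(z)/(N+1)`; the elementary inequality
  `‖w − v‖² (1 − ψ_L(‖w − v‖)) ≤ 4 velTail L v + 4 velTail L w` (`sq_mul_one_sub_speedCutoff_le`) makes
  it control the Enskog side of the truncation (a second-moment tail of the empirical velocity law);
* `gaussVelTail u θ L = ∫ velTail L dN(u, θ·id)` — the **Gaussian velocity tail** (the value of the
  mean tail energy under a homogeneous Gibbs law), `→ 0` as `L → ∞` (`tendsto_gaussVelTail`), and its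
  uniform majorant `domGaussTail U Θ L` over `‖u‖ ≤ U`, `θ ≤ Θ` (`gaussVelTail_le_domGaussTail`,
  `tendsto_domGaussTail`), for local Gibbs laws with continuous profiles.

References: Chapman–Cowling (1970) Ch. 16 (collisional transfer of the dense hard-sphere gas);
H. Spohn, *Large Scale Dynamics of Interacting Particles* (1991), Part I §2.3 (local equilibrium
states: Gaussian velocities given the positions).
-/

noncomputable section

open MeasureTheory Set Filter Topology
open scoped ENNReal InnerProductSpace BigOperators

namespace Literature.MathematicalPhysics.KineticTheory

open Literature.Analysis.FluidPDE

/-! ## The speed-tail mark -/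

/-- The **speed-tail mark** `m_L(n, v, w) = ‖w − v‖ · (1 − ψ_L(‖w − v‖))`: continuous, nonnegative,
vanishing for `‖w − v‖ ≤ L`, bounded by `‖w − v‖ · 1{L < ‖w − v‖}`; it dominates `|Ξ_P − Ξ_L|` at unit
normal (`abs_evenMark_sub_evenMarkTrunc_le`). [folklore] -/
def speedTailMark (L : ℝ) (q : V3 × V3 × V3) : ℝ :=
  ‖q.2.2 - q.2.1‖ * (1 - speedCutoff L ‖q.2.2 - q.2.1‖)

/-- The speed-tail mark is continuous. [folklore] -/
theorem continuous_speedTailMark (L : ℝ) : Continuous (speedTailMark L) := by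
  unfold speedTailMark speedCutoff
  fun_prop

/-- The speed-tail mark is nonnegative. [folklore] -/
theorem speedTailMark_nonneg (L : ℝ) (q : V3 × V3 × V3) : 0 ≤ speedTailMark L q :=
  mul_nonneg (norm_nonneg _) (sub_nonneg.2 (speedCutoff_mem_Icc L _).2)

/-- The speed-tail mark is at most the relative speed. [folklore] -/
theorem speedTailMark_le_norm (L : ℝ) (q : V3 × V3 × V3) : speedTailMark L q ≤ ‖q.2.2 - q.2.1‖ :=
  mul_le_of_le_one_right (norm_nonneg _) (sub_le_self _ (speedCutoff_mem_Icc L _).1)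

/-- The speed-tail mark vanishes at relative speed `≤ L` (`0 < L`). [folklore] -/
theorem speedTailMark_eq_zero_of_le {L : ℝ} (hL : 0 < L) {q : V3 × V3 × V3}
    (h : ‖q.2.2 - q.2.1‖ ≤ L) : speedTailMark L q = 0 := by
  unfold speedTailMark
  rw [speedCutoff_eq_one hL h, sub_self, mul_zero]

/-- **The truncation error of the even mark at unit normal is dominated by the speed-tail mark**:
`|Ξ_P^{kl}(n,v,w) − Ξ_L^{kl}(n,v,w)| ≤ ‖w − v‖(1 − ψ_L(‖w − v‖))` for `‖n‖ = 1`, `0 < L` (below `2L`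
the truncation only multiplies `Ξ_P` by `ψ_L`, and `|Ξ_P| ≤ ‖w − v‖`; beyond `2L`, `Ξ_L = 0`).
[folklore] -/
theorem abs_evenMark_sub_evenMarkTrunc_le (k l : Fin 3) {L : ℝ} (hL : 0 < L) {q : V3 × V3 × V3}
    (hn : ‖q.1‖ = 1) : |evenMark k l q - evenMarkTrunc k l L q| ≤ speedTailMark L q := by
  by_cases h2 : 2 * L ≤ ‖q.2.2 - q.2.1‖
  · rw [evenMarkTrunc_eq_zero_of_le k l hL h2, sub_zero]
    unfold speedTailMark
    rw [speedCutoff_eq_zero hL h2, sub_zero, mul_one]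
    exact abs_evenMark_le k l hn
  · push Not at h2
    have hk : |q.1 k| ≤ 1 := by
      have := PiLp.norm_apply_le q.1 k
      rw [hn, Real.norm_eq_abs] at this
      exact this
    have hl : |q.1 l| ≤ 1 := by
      have := PiLp.norm_apply_le q.1 l
      rw [hn, Real.norm_eq_abs] at this
      exact this
    have ha : max ⟪q.2.2 - q.2.1, q.1⟫_ℝ 0 ≤ 2 * L := by
      refine max_le ?_ (by linarith)
      calc ⟪q.2.2 - q.2.1, q.1⟫_ℝ ≤ ‖q.2.2 - q.2.1‖ * ‖q.1‖ := real_inner_le_norm _ _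
        _ = ‖q.2.2 - q.2.1‖ := by rw [hn, mul_one]
        _ ≤ 2 * L := h2.le
    have hfac : evenMarkTrunc k l L q = evenMark k l q * speedCutoff L ‖q.2.2 - q.2.1‖ := by
      unfold evenMarkTrunc evenMark
      rw [min_eq_left ha, clip1_eq_self hk, clip1_eq_self hl]
    have hψ := speedCutoff_mem_Icc L ‖q.2.2 - q.2.1‖
    rw [hfac, show evenMark k l q - evenMark k l q * speedCutoff L ‖q.2.2 - q.2.1‖ =
      evenMark k l q * (1 - speedCutoff L ‖q.2.2 - q.2.1‖) by ring, abs_mul,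
      abs_of_nonneg (sub_nonneg.2 hψ.2)]
    exact mul_le_mul_of_nonneg_right (abs_evenMark_le k l hn) (sub_nonneg.2 hψ.2)

/-! ## The velocity tail and the tail kinetic energy -/

/-- The single-particle **velocity tail** `t_L(v) = ‖v‖² · 1{L/2 < ‖v‖}`. [folklore] -/
def velTail (L : ℝ) (v : V3) : ℝ := if L / 2 < ‖v‖ then ‖v‖ ^ 2 else 0

/-- The velocity tail is nonnegative. [folklore] -/
theorem velTail_nonneg (L : ℝ) (v : V3) : 0 ≤ velTail L v := by
  unfold velTail; split_ifs <;> positivity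

/-- The velocity tail is at most `‖v‖²`. [folklore] -/
theorem velTail_le (L : ℝ) (v : V3) : velTail L v ≤ ‖v‖ ^ 2 := by
  unfold velTail; split_ifs
  exacts [le_rfl, sq_nonneg _]

/-- The velocity tail is measurable. [folklore] -/
theorem measurable_velTail (L : ℝ) : Measurable (velTail L) := by
  unfold velTail
  exact Measurable.ite (measurableSet_lt measurable_const measurable_norm)
    (measurable_norm.pow_const 2) measurable_const

/-- **The tail kinetic energy per particle** `T_L(z) = (N+1)⁻¹ Σᵢ ‖vᵢ‖² 1{L/2 < ‖vᵢ‖}` of a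
configuration of `N + 1` spheres (twice the kinetic energy carried by the particles faster than `L/2`,
per particle). [folklore] -/
def tailEnergy {N : ℕ} (L : ℝ) (z : Config (N + 1) (Fin 3) T3) : ℝ :=
  ((N + 1 : ℕ) : ℝ)⁻¹ * ∑ i, velTail L (z i).2

/-- The tail kinetic energy is nonnegative. [folklore] -/
theorem tailEnergy_nonneg {N : ℕ} (L : ℝ) (z : Config (N + 1) (Fin 3) T3) : 0 ≤ tailEnergy L z :=
  mul_nonneg (inv_nonneg.2 (Nat.cast_nonneg _)) (Finset.sum_nonneg fun _ _ => velTail_nonneg L _)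

/-- The tail kinetic energy is measurable. [folklore] -/
theorem measurable_tailEnergy {N : ℕ} (L : ℝ) :
    Measurable (tailEnergy (N := N) L) := by
  unfold tailEnergy
  refine measurable_const.mul (Finset.measurable_sum _ fun i _ => ?_)
  exact (measurable_velTail L).comp (measurable_pi_apply i).snd

/-- The tail kinetic energy is at most twice the kinetic energy per particle:
`T_L(z) ≤ (N+1)⁻¹ Σᵢ ‖vᵢ‖² = 2 E(z)/(N+1)`. [folklore] -/
theorem tailEnergy_le_configEnergy {N : ℕ} (L : ℝ) (z : Config (N + 1) (Fin 3) T3) :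
    tailEnergy L z ≤ 2 * configEnergy z / ((N + 1 : ℕ) : ℝ) := by
  unfold tailEnergy configEnergy
  rw [div_eq_inv_mul]
  refine mul_le_mul_of_nonneg_left ?_ (inv_nonneg.2 (Nat.cast_nonneg _))
  rw [← mul_assoc, show (2 : ℝ) * 2⁻¹ = 1 by norm_num, one_mul]
  exact Finset.sum_le_sum fun i _ => velTail_le L _

/-- The elementary tail inequality behind the Enskog side of the truncation:
`‖w − v‖² (1 − ψ_L(‖w − v‖)) ≤ 4 t_L(v) + 4 t_L(w)` — a pair of relative speed `> L` has a partner
faster than `L/2`, which carries at least a quarter of the squared relative speed. [folklore] -/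
theorem sq_mul_one_sub_speedCutoff_le {L : ℝ} (hL : 0 < L) (v w : V3) :
    ‖w - v‖ ^ 2 * (1 - speedCutoff L ‖w - v‖) ≤ 4 * velTail L v + 4 * velTail L w := by
  have htv := velTail_nonneg L v
  have htw := velTail_nonneg L w
  by_cases h : ‖w - v‖ ≤ L
  · rw [speedCutoff_eq_one hL h, sub_self, mul_zero]
    positivity
  · push Not at h
    have h1 : ‖w - v‖ ^ 2 * (1 - speedCutoff L ‖w - v‖) ≤ ‖w - v‖ ^ 2 :=
      mul_le_of_le_one_right (sq_nonneg _) (sub_le_self _ (speedCutoff_mem_Icc L _).1)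
    refine h1.trans ?_
    have hwv : ‖w - v‖ ≤ ‖w‖ + ‖v‖ := norm_sub_le w v
    rcases le_total ‖v‖ ‖w‖ with hvw | hvw
    · have h2 : ‖w - v‖ ≤ 2 * ‖w‖ := by linarith
      have h3 : L / 2 < ‖w‖ := by linarith
      have h4 : velTail L w = ‖w‖ ^ 2 := by unfold velTail; rw [if_pos h3]
      have h5 : ‖w - v‖ ^ 2 ≤ (2 * ‖w‖) ^ 2 := pow_le_pow_left₀ (norm_nonneg _) h2 2
      nlinarith
    · have h2 : ‖w - v‖ ≤ 2 * ‖v‖ := by linarith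
      have h3 : L / 2 < ‖v‖ := by linarith
      have h4 : velTail L v = ‖v‖ ^ 2 := by unfold velTail; rw [if_pos h3]
      have h5 : ‖w - v‖ ^ 2 ≤ (2 * ‖v‖) ^ 2 := pow_le_pow_left₀ (norm_nonneg _) h2 2
      nlinarith

/-! ## Gaussian velocity tails -/

/-- The **Gaussian velocity tail** `t(u, θ, L) = ∫ ‖v‖² 1{L/2 < ‖v‖} dN(u, θ·id)(v)` (`gaussMeasure`
of `HardSphereEulerProofs`). [folklore] -/
def gaussVelTail (u : V3) (θ L : ℝ) : ℝ≥0∞ :=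
  ∫⁻ v, ENNReal.ofReal (velTail L v) ∂gaussMeasure u θ

/-- **The Gaussian velocity tail vanishes as `L → ∞`** (dominated convergence: `‖v‖²` is integrable
under a Gaussian law, and `1{L/2 < ‖v‖} → 0` pointwise). [folklore] -/
theorem tendsto_gaussVelTail (u : V3) (θ : ℝ) : Tendsto (fun L : ℝ => gaussVelTail u θ L) atTop (𝓝 0) := by
  have hint : Integrable (fun v : V3 => ‖v‖ ^ 2) (gaussMeasure u θ) := by
    have h := (ProbabilityTheory.IsGaussian.memLp_id (gaussMeasure u θ) 2 (by simp)).integrable_norm_pow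
      (by norm_num)
    simpa using h
  have hlim : ∀ v : V3, Tendsto (fun L : ℝ => ENNReal.ofReal (velTail L v)) atTop (𝓝 0) := by
    intro v
    refine tendsto_const_nhds.congr' ?_
    filter_upwards [eventually_gt_atTop (2 * ‖v‖)] with L hL
    have h : ¬ (L / 2 < ‖v‖) := by push Not; linarith
    simp only [velTail, if_neg h, ENNReal.ofReal_zero]
  have h := tendsto_lintegral_filter_of_dominated_convergence (μ := gaussMeasure u θ)
    (l := atTop) (F := fun (L : ℝ) (v : V3) => ENNReal.ofReal (velTail L v)) (f := fun _ => 0)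
    (fun v => ENNReal.ofReal (‖v‖ ^ 2))
    (Eventually.of_forall fun L => (measurable_velTail L).ennreal_ofReal)
    (Eventually.of_forall fun L => ae_of_all _ fun v => ENNReal.ofReal_le_ofReal (velTail_le L v))
    hint.lintegral_lt_top.ne (ae_of_all _ hlim)
  unfold gaussVelTail
  simpa only [lintegral_zero] using h

/-- The **dominating Gaussian tail** `G(U, Θ, L) = ∫ (U + √Θ‖w‖)² 1{L/2 < U + √Θ‖w‖} dγ(w)` over the
standard Gaussian `γ` of `ℝ³`: it dominates `t(u, θ, L)` for `‖u‖ ≤ U`, `θ ≤ Θ`. [folklore] -/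
def domGaussTail (U Θ L : ℝ) : ℝ≥0∞ :=
  ∫⁻ w, ENNReal.ofReal (if L / 2 < U + Real.sqrt Θ * ‖w‖ then (U + Real.sqrt Θ * ‖w‖) ^ 2 else 0)
    ∂ProbabilityTheory.stdGaussian V3

/-- `t(u, θ, L) ≤ G(U, Θ, L)` for `‖u‖ ≤ U` and `θ ≤ Θ` (`‖u + √θ w‖ ≤ U + √Θ‖w‖`). [folklore] -/
theorem gaussVelTail_le_domGaussTail {u : V3} {θ U Θ : ℝ} (hu : ‖u‖ ≤ U) (hθ : θ ≤ Θ) (L : ℝ) :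
    gaussVelTail u θ L ≤ domGaussTail U Θ L := by
  unfold gaussVelTail domGaussTail gaussMeasure
  rw [lintegral_map (measurable_velTail L).ennreal_ofReal (measurable_gaussShift u θ)]
  refine lintegral_mono fun w => ENNReal.ofReal_le_ofReal ?_
  have hR : ‖u + Real.sqrt θ • w‖ ≤ U + Real.sqrt Θ * ‖w‖ := by
    calc ‖u + Real.sqrt θ • w‖ ≤ ‖u‖ + ‖Real.sqrt θ • w‖ := norm_add_le _ _
      _ = ‖u‖ + Real.sqrt θ * ‖w‖ := by
          rw [norm_smul, Real.norm_eq_abs, abs_of_nonneg (Real.sqrt_nonneg θ)]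
      _ ≤ U + Real.sqrt Θ * ‖w‖ :=
          add_le_add hu (mul_le_mul_of_nonneg_right (Real.sqrt_le_sqrt hθ) (norm_nonneg _))
  have hR0 : 0 ≤ U + Real.sqrt Θ * ‖w‖ := (norm_nonneg _).trans hR
  unfold velTail
  by_cases h : L / 2 < ‖u + Real.sqrt θ • w‖
  · rw [if_pos h, if_pos (h.trans_le hR)]
    exact pow_le_pow_left₀ (norm_nonneg _) hR 2
  · rw [if_neg h]
    split_ifs <;> positivity

/-- **The dominating Gaussian tail vanishes as `L → ∞`** (dominated convergence). [folklore] -/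
theorem tendsto_domGaussTail (U Θ : ℝ) : Tendsto (fun L : ℝ => domGaussTail U Θ L) atTop (𝓝 0) := by
  have hmeasR : Measurable fun w : V3 => U + Real.sqrt Θ * ‖w‖ :=
    measurable_const.add (measurable_const.mul measurable_norm)
  have hmeas : ∀ L : ℝ, Measurable fun w : V3 =>
      ENNReal.ofReal (if L / 2 < U + Real.sqrt Θ * ‖w‖ then (U + Real.sqrt Θ * ‖w‖) ^ 2 else 0) :=
    fun L => (Measurable.ite (measurableSet_lt measurable_const hmeasR) (hmeasR.pow_const 2)
      measurable_const).ennreal_ofReal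
  have hint : Integrable (fun w : V3 => 2 * U ^ 2 + 2 * Θ⁺ * ‖w‖ ^ 2) (ProbabilityTheory.stdGaussian V3) :=
    (integrable_const _).add (integrable_norm_sq_stdGaussian.const_mul _)
  have hdom : ∀ (L : ℝ) (w : V3),
      ENNReal.ofReal (if L / 2 < U + Real.sqrt Θ * ‖w‖ then (U + Real.sqrt Θ * ‖w‖) ^ 2 else 0) ≤
        ENNReal.ofReal (2 * U ^ 2 + 2 * Θ⁺ * ‖w‖ ^ 2) := by
    intro L w
    refine ENNReal.ofReal_le_ofReal ?_
    have hsq : Real.sqrt Θ ^ 2 = Θ⁺ := by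
      rcases le_total 0 Θ with hΘ | hΘ
      · rw [Real.sq_sqrt hΘ, posPart_eq_self.2 hΘ]
      · rw [Real.sqrt_eq_zero'.2 hΘ, posPart_eq_zero.2 hΘ]; ring
    have h2 : (U + Real.sqrt Θ * ‖w‖) ^ 2 ≤ 2 * U ^ 2 + 2 * Θ⁺ * ‖w‖ ^ 2 := by
      rw [← hsq]; nlinarith [sq_nonneg (U - Real.sqrt Θ * ‖w‖)]
    split_ifs
    · exact h2
    · nlinarith [sq_nonneg U, sq_nonneg ‖w‖, posPart_nonneg Θ]
  have hlim : ∀ w : V3, Tendsto (fun L : ℝ =>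
      ENNReal.ofReal (if L / 2 < U + Real.sqrt Θ * ‖w‖ then (U + Real.sqrt Θ * ‖w‖) ^ 2 else 0))
        atTop (𝓝 0) := by
    intro w
    refine tendsto_const_nhds.congr' ?_
    filter_upwards [eventually_gt_atTop (2 * (U + Real.sqrt Θ * ‖w‖))] with L hL
    have h : ¬ (L / 2 < U + Real.sqrt Θ * ‖w‖) := by push Not; linarith
    simp only [if_neg h, ENNReal.ofReal_zero]
  have h := tendsto_lintegral_filter_of_dominated_convergence (μ := ProbabilityTheory.stdGaussian V3)
    (l := atTop) (f := fun _ => 0) (fun w => ENNReal.ofReal (2 * U ^ 2 + 2 * Θ⁺ * ‖w‖ ^ 2))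
    (Eventually.of_forall hmeas) (Eventually.of_forall fun L => ae_of_all _ (hdom L))
    hint.lintegral_lt_top.ne (ae_of_all _ hlim)
  unfold domGaussTail
  simpa only [lintegral_zero] using h

end Literature.MathematicalPhysics.KineticTheory

end
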